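import Literature.IUT.HodgeArakelov.CoreTowerGenuinePinned
import HarnessLib

/-!
# [IUTchII] Rmk. 1.1.1 (iv), model-embedding clause: `Π_M ↪ Π_μ(M) ⋊ Π_C(M)` PROVED at the [EtTh] model frame, and
# INHABITED at the genuine core tower with the GENUINE `Π_C(M)`-action on `Π_μ(M)` (the cyclotomic character of `augC`)

Mochizuki, *Inter-universal Teichmüller theory II*, §1, Remark 1.1.1 (iv), kurims manuscript (Dec. 2020) p. 24 l. 4–10:
«up to composition with automorphisms of `Π_M` that differ from the identity automorphism by a twisted homomorphism
`Π_M ↠ Π_Y(M) ↠ Π^ell_Y(M) → Π_μ(M)` … the model embedding `Π_M ↪ Π_μ(M) ⋊ Π_C(M)` may be reconstructed algorithmically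
from the mono-theta environment `M`» [claim: Mochizuki2012, status: disputed] (IUTchII §1 Rmk 1.1.1 (iv), kurims p.24);
[EtTh] Def. 2.13 (ii) p. 47 («`Π ≅ Π^tp_{Y̲}[μ_N]`»), Cor. 2.18 (iv) p. 60 [cite: MochizukiEtTh2009, Cor 2.18 (iv) p.60].

Cell abc-iut, seat abc-iut-w4-d018 (gen 7), NODES row IUTchII:Rmk1.1.1(iv), residual **(iv)-E** «model embedding
`Π_M ↪ Π_μ ⋊ Π_C` at a genuine `φ`» (NODES v3.4bl: «FACT-keyed F-0624/F-0647 + D-G-w4d010-2f BY ID», never kernel-inhabited).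
PROOF-ONLY (0 `def` / `instance` / `structure`). abc-iut-L6-t1 typed the clause as the predicate
`Rmk111_iv_modelEmbedding R W φ` (`MonoThetaSymmetries.lean`, p405595): IF `φ : Π_C(M) →* Aut(Π_μ(M))` extends the natural
`Π_X(M)`-action `extAct` along `isoXbarbar : Π_X(M) ⥲ Π_X̲̲ ⊆ Π_C(M)`, THEN there is an injective homomorphism
`ι : Π_M →* Π_μ(M) ⋊_φ Π_C(M)` with `ι|_{Π_μ(M)} = inl` and right coordinate `isoXbarbar ∘ (Π_M ↠ Π_Y(M) ⊆ Π_X(M))`. Here: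

* **`ModelFrame.rmk111_iv_modelEmbedding_holds`** — at ANY [EtTh] model frame `F` (abc-iut-L6-d6's `F.reconstruction e` of a
  mono-theta environment identified by `e : Π_M ≃ Π^tp_{Y̲̲}[μ_N] = μ_N ⋊ Π^tp_{Y̲̲}`), for EVERY core tower `W` and EVERY `φ`, the
  predicate HOLDS: `ι g := (extEquiv (e g).left, isoXbarbar (e g).right)` is multiplicative precisely because `φ ∘ isoXbarbar =
  extAct = χ ∘ aug` on `Π^tp_{Y̲̲}` (`reconstruction_extAct_apply`) — the printed «model embedding» IS the defining semidirect
  product structure of `Π^tp_{Y̲̲}[μ_N]`, pushed into `Π_μ(M) ⋊ Π_C(M)`;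
* **`ModelFrame.exists_rmk111_iv_modelEmbedding_genuine`** — NON-VACUITY at the genuine frame: at the genuine core tower of
  `exists_coreTower_pinned_of_cLevelData` (gen 7, p466913; `j : Π_C(M) ≃* Π^tp_C`, `j ∘ isoXbarbar = inclX`) the GENUINE action
  `φ c := μ_N ∋ m ↦ χ(augC (j c)) · m` (the cyclotomic character of abc-iut-L2-d3's augmentation `augC : Π^tp_C → G_K`, read on
  `Π_μ(M)` through `extEquiv`) SATISFIES the hypothesis (`augC ∘ inclX = aug`), hence the clause holds for it — (iv)-E is
  kernel-inhabited at a genuine `φ`, no FACT id consumed.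

BINDER CENSUS (BY NAME; no `Prop` fact introduced, no FACT-LIST row consumed): the frame `F`, `e`; for the genuine instance
`cl : CLevelData`, `hO : IsEtThOrigin`, `hYcl`, `hR1c` (the binders of p466913). HONEST FRAMING: kernel facts about the cell's own
typed interfaces and model; the uniqueness clause «up to … twisted homomorphism» is recorded in prose by L6-t1 and not treated;
nothing of [IUTchII] is asserted; Rmk. 1.1.1 is outside the [IUTchIII] Cor. 3.12 cone; no side taken on Cor. 3.12; typed ≠ proved;
constructed ≠ endorsed.
-/

noncomputable section

namespace Literature.IUT.HodgeArakelov

open Literature.AnabelianGeometry.EtaleTheta Literature.AnabelianGeometry.SemiGraphs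
open scoped Literature.AnabelianGeometry.EtaleTheta

namespace ModelFrame

universe u

section AnyFrame

variable {S : ThetaSetting.{u}} {l : ℕ} {R : RigidData.{u} S.N l} (F : ModelFrame S R) {M : MonoThetaEnv S}
  (e : M.Pi ≃ₜ* R.env)

/-- **IUTchII:Rmk1.1.1(iv), model-embedding clause, PROVED at every [EtTh] model frame.** For every core tower `W` over
`F.reconstruction e` and every `φ : Π_C(M) →* Aut(Π_μ(M))`, L6-t1's predicate `Rmk111_iv_modelEmbedding (F.reconstruction e) W φ`
holds: if `φ` extends `extAct` along `isoXbarbar`, then `g ↦ (extEquiv (e g).left, isoXbarbar (e g).right)` is an injective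
homomorphism `Π_M →* Π_μ(M) ⋊_φ Π_C(M)` restricting to `inl` on `Π_μ(M)` with right coordinate `isoXbarbar ∘ (Π_M ↠ Π_Y(M))`.
[claim: Mochizuki2012, status: disputed] (IUTchII §1 Rmk 1.1.1 (iv), kurims p.24) -/
theorem rmk111_iv_modelEmbedding_holds (W : CoreTower (F.reconstruction e))
    (φ : W.PiC →* MulAut (F.reconstruction e).extCyc) : Rmk111_iv_modelEmbedding (F.reconstruction e) W φ := by
  intro hφ
  -- ### the right coordinate `Π_M ↠ Π_Y(M) ⊆ Π_X(M) ⥲ Π_X̲̲ ⊆ Π_C(M)` as a homomorphism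
  let cHom : M.Pi →* W.PiC := W.Xbarbar.subtype.comp (W.isoXbarbar.toMulEquiv.toMonoidHom.comp
    ((F.reconstruction e).inclY.comp (F.reconstruction e).projY))
  have hc : ∀ g : M.Pi, cHom g =
      (W.isoXbarbar ((F.reconstruction e).inclY ((F.reconstruction e).projY g)) : W.PiC) := fun _ => rfl
  have hprojY : ∀ g : M.Pi, (F.reconstruction e).projY g = (e g).right := fun _ => rfl
  -- `φ` on the right coordinate is the cyclotomic character of `aug (e g).right` (hypothesis `hφ` + `extAct` of the model)
  have hφc : ∀ (g : M.Pi) (m : ↥(F.reconstruction e).extCyc),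
      φ (cHom g) m = extEquiv e (R.chi (R.aug (((e g).right : ↥R.PiY) : R.PiX)) ((extEquiv e).symm m)) := by
    intro g m
    rw [hc, hφ, reconstruction_extAct_apply]
    rfl
  -- ### the embedding
  let ι : M.Pi →* (↥(F.reconstruction e).extCyc) ⋊[φ] W.PiC :=
    { toFun := fun g => ⟨extEquiv e (e g).left, cHom g⟩
      map_one' := by
        apply SemidirectProduct.ext
        · rw [SemidirectProduct.one_left, map_one, SemidirectProduct.one_left, map_one]
        · change cHom 1 = 1
          rw [map_one]
      map_mul' := fun g h => by
        apply SemidirectProduct.ext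
        · rw [SemidirectProduct.mul_left, map_mul, SemidirectProduct.mul_left, map_mul, hφc, MulEquiv.symm_apply_apply]
          rfl
        · change cHom (g * h) = cHom g * cHom h
          rw [map_mul] }
  have hι : ∀ g : M.Pi, ι g = ⟨extEquiv e (e g).left, cHom g⟩ := fun _ => rfl
  refine ⟨ι, ?_, ?_, ?_⟩
  · -- injectivity: both coordinates of `e g` are recovered
    rw [injective_iff_map_eq_one]
    intro g hg
    rw [hι] at hg
    have hl : extEquiv e (e g).left = 1 := by
      have h := congrArg SemidirectProduct.left hg
      rwa [SemidirectProduct.one_left] at h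
    have hr : cHom g = 1 := by
      have h := congrArg SemidirectProduct.right hg
      rwa [SemidirectProduct.one_right] at h
    rw [MulEquiv.map_eq_one_iff] at hl
    have hr' : (e g).right = 1 := by
      rw [hc] at hr
      have h1 : W.isoXbarbar ((F.reconstruction e).inclY ((F.reconstruction e).projY g)) = 1 := by
        apply Subtype.ext
        rw [hr]
        rfl
      rw [map_eq_one_iff W.isoXbarbar W.isoXbarbar.injective] at h1
      have h2 : (((e g).right : ↥R.PiY) : R.PiX) = 1 := h1
      exact Subtype.ext h2
    apply e.injective
    rw [map_one]
    exact SemidirectProduct.ext hl hr'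
  · -- on `Π_μ(M) = Ker(Π_M ↠ Π_Y(M))` the embedding is `inl`
    intro m
    have hm : (e (m : M.Pi)).right = 1 := (MonoidHom.mem_ker).1 m.2
    rw [hι]
    apply SemidirectProduct.ext
    · rw [SemidirectProduct.left_inl]
      apply Subtype.ext
      rw [coe_extEquiv]
      apply e.injective
      rw [ContinuousMulEquiv.apply_symm_apply]
      exact (SemidirectProduct.ext rfl hm.symm : CycEnvelope.inMu R.augY R.chi (e (m : M.Pi)).left = e (m : M.Pi))
    · rw [SemidirectProduct.right_inl, hc, hprojY, hm, map_one, map_one]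
      rfl
  · -- the right coordinate is `isoXbarbar ∘ inclY ∘ projY`
    intro g
    rfl

end AnyFrame

section Genuine

variable {p : ℕ} [Fact p.Prime] {Mt : MuTwoSetting p}
  {E : Mt.toThetaSetting.EtaleThetaData} {l : ℕ} (C : E.DoubleUnderline l)
  {S : ThetaSetting.{0}} (μ : Mt.toThetaSetting.CyclotomeMod l S.N)
  (hC : Mt.toThetaSetting.Compat) (hS : Mt.toThetaSetting.Sec2Hyps)
  (h15 : ThetaSetting.Prop15iii E hC) (L : C.CuspLabels)
  (F : ModelFrame S (C.rigidData μ hC hS h15 L)) {Menv : MonoThetaEnv S}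
  (e : Menv.Pi ≃ₜ* (C.rigidData μ hC hS h15 L).env)

/-- **IUTchII:Rmk1.1.1(iv), model-embedding clause, INHABITED AT THE GENUINE FRAME WITH THE GENUINE ACTION.** At the
genuine core tower of `exists_coreTower_pinned_of_cLevelData` (`j : Π_C(M) ≃* Π^tp_C`, `Δ_C(M) = Ker(augC ∘ j)`,
`j ∘ isoXbarbar = inclX`) the action `φ c = χ(augC (j c))` of `Π^tp_C` on `Π_μ(M) ≅ μ_N` through the CYCLOTOMIC CHARACTER of
abc-iut-L2-d3's augmentation `augC : Π^tp_C → G_K` extends the natural `Π_X(M)`-action (`augC ∘ inclX = aug`), and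
`Rmk111_iv_modelEmbedding (F.reconstruction e) W φ` holds for it: the model embedding `Π_M ↪ Π_μ(M) ⋊ Π_C(M)` exists at a
GENUINE `φ`. [claim: Mochizuki2012, status: disputed] (IUTchII §1 Rmk 1.1.1 (iv), kurims p.24) -/
theorem exists_rmk111_iv_modelEmbedding_genuine (cl : Mt.CLevelData) (hO : Mt.toThetaSetting.IsEtThOrigin)
    (hYcl : (Mt.DtpY.map Mt.toHat.toMonoidHom).topologicalClosure ≤
      Mt.DtpY.map Mt.toHat.toMonoidHom ⊔ (⁅⁅Mt.DeltaHat, Mt.DeltaHat⁆, Mt.DeltaHat⁆).topologicalClosure)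
    (hR1c : ∀ x : Mt.PiTemp, Mt.toZ (cl.conjX Mt.epsPM x) = (Mt.toZ x)⁻¹) :
    ∃ (W : CoreTower (F.reconstruction e)) (j : W.PiC ≃* Mt.GtpC)
      (φ : W.PiC →* MulAut (F.reconstruction e).extCyc),
      (∀ c : W.PiC, c ∈ W.DeltaC ↔ cl.augC (j c) = 1) ∧
      (∀ x : ↥C.Huu, j ((W.isoXbarbar x : ↥W.Xbarbar) : W.PiC) = Mt.inclX (x : Mt.PiTemp)) ∧
      W.kerEll = ((Mt.thetaToEll.comp Mt.toTheta).ker).comap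
        (C.Huu.subtype.comp (Mt.GtpY.subgroupOf C.Huu).subtype) ∧
      (∀ (c : W.PiC) (m : ↥(F.reconstruction e).extCyc),
        φ c m = extEquiv e (galMuN p S.N (cl.augC (j c)) ((extEquiv e).symm m))) ∧
      (∀ x : ↥C.Huu, φ ((W.isoXbarbar x : ↥W.Xbarbar) : W.PiC) = (F.reconstruction e).extAct x) ∧
      Rmk111_iv_modelEmbedding (F.reconstruction e) W φ := by
  obtain ⟨W, j, hΔ, hj, -, -, -, hker, -, -⟩ :=
    exists_coreTower_pinned_of_cLevelData C μ hC hS h15 L F e cl hO hYcl hR1c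
  -- the genuine action: the cyclotomic character of `augC ∘ j`, read on `Π_μ(M)` through `extEquiv`
  let φ : W.PiC →* MulAut (F.reconstruction e).extCyc :=
    (MulAut.congr (extEquiv e)).toMonoidHom.comp ((galMuN p S.N).comp (cl.augC.toMonoidHom.comp j.toMonoidHom))
  have hφ : ∀ (c : W.PiC) (m : ↥(F.reconstruction e).extCyc),
      φ c m = extEquiv e (galMuN p S.N (cl.augC (j c)) ((extEquiv e).symm m)) := fun _ _ => rfl
  have hφX : ∀ x : ↥C.Huu, φ ((W.isoXbarbar x : ↥W.Xbarbar) : W.PiC) = (F.reconstruction e).extAct x := by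
    intro x
    apply MulEquiv.ext
    intro m
    rw [hφ, hj, cl.augC_inclX, reconstruction_extAct_apply]
    rfl
  exact ⟨W, j, φ, hΔ, hj, hker, hφ, hφX, rmk111_iv_modelEmbedding_holds F e W φ⟩

end Genuine

end ModelFrame

end Literature.IUT.HodgeArakelov

end
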